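import Summits.QuantumFields.BalabanUV.T4Continuum.Support.NE7DecompOfDirectLettersSlice
import HarnessLib

/-!
# NE7DecompOfLettersGeneric — THE `hdecomp♭` BODY FROM AN EXACT SLICE SPLIT `X₀ = X_T + X_N`, THE THREE ℓ-LETTERS OF THE NORMAL PART AGAINST A COARSE DATUM `φ`, AND THE TWO DIRECT
# LETTERS OF `φ` — `NE7DecompOfDirectLettersSlice.decomp_of_directLetters_coarse` with row NE3's `rightInvW` replaced by an ARBITRARY normal part `X_N` whose letters (R1)–(R3) are
# DISPLAYED with constants `c₁, c₂, c₃` (memo ROAD-G103 §7 (J2); consumer: the frame-free right inverse `R₀` of `NE7FrameFreeRightInverse`, letters `NE7FrameFreeRightInverseLetters`)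

Cell `pub-balaban`, rung (B)+1 sub-cell t4, lineage `b2b-balaban-t4-ne7-p1`, generation 104 (CRUX PROVER NE7 #1 = OWNER of BINDER row NE7).  Memo `t4/b2b-balaban-t4-ne7-p1-g103/ROAD-G103.md` §7.
WHAT ([folklore]; 0 def, 0 sorry).  **`decomp_of_letters`**: level `k+1`, `M = L^{k+1}`, `F = periodBox (N·M)`; a unitary gauge `u` with `U′^{u} = U♯·e^{X₀}`, `X₀` skew `(N·M)`-periodic, `sup‖X₀‖ ≤ α₀`;
a normal part `X_N` with `X₀ − X_N ∈ 𝒯 k U♯` (`𝒯` skew-valued) and the letters (R1) `dirSq X_N F ≤ c₁·(M^d∕M²)·dirSq φ [0,N)^d`, (R2) `curlSq U♯ X_N F ≤ c₂·(M^d∕M⁴)·dirSq φ [0,N)^d`,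
(R3) `Σ_{perWin}‖curl U♯ X_N‖ ≤ c₃·(M^d∕M²)·dirL1 φ [0,N)^d`; the direct letters (DL2) `(M^d∕M⁴)·dirSq φ ≤ q₂²·‖X₀‖_w²`, (DL1) `(M^d∕M⁴)·dirL1 φ ≤ q₁·‖X₀‖_w²` ⟹ the `hdecomp♭` body with
`X_T := X₀ − X_N`, `α = α₀`, `ν = √(c₁+c₂)·q₂`, `κ = ε·c₃·q₁`.  Pure real arithmetic (`‖·‖_w² = curlSq + M⁻²·dirSq`).
HONEST FRAMING (page 1): bookkeeping; every letter is a displayed hypothesis asserted for nothing; nothing of Bałaban's asserted; NOT NE7; spine 0∕9; finite T⁴ rung (B)+1 — NOT infinite volume, NOT mass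
gap, NOT BetaPertH, NOT Clay (continuum YM on T⁴ ⇐ BetaPertH ∧ nine spine estimates, 0/9 proved).
-/

set_option autoImplicit false

open scoped BigOperators Matrix Matrix.Norms.L2Operator
open NormedSpace Finset Set

namespace Summit.QuantumFields.BalabanUV.T4Continuum.NE7DecompOfLettersGeneric

open Literature.MathematicalPhysics.QuantumFieldTheory.Balaban1983to89
open B7Prop1Explicit B7Prop2Explicit
open T4AveragingDeficitWall (IsUnitaryCfg IsSkewDir SmallField vary curl curlSq dirSq dirL1)
open T4AveragingDeficitWallBoundary (IsPeriodicCfg periodBox)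
open AveragingDeficitPeriodicCounting (IsPeriodicDir)
open MinimalActionLevels (perWin)
open NE3EnergyShapes (IsUnitarySite IsPeriodicSite)
open NE3EnergyWeightedShapes (energyNormW energyNormW_nonneg)
open NE3ProductPathBounds (energySq_nonneg)
open NE3EnergyHessContTwoTerm (curlSq_nonneg dirSq_nonneg)

noncomputable section

variable {d : ℕ} {n : Type*} [Fintype n] [DecidableEq n]

/-- **THE `hdecomp♭` BODY FROM A SLICE SPLIT, THE NORMAL PART'S THREE ℓ-LETTERS AND THE TWO DIRECT LETTERS** (statement in the file header). [folklore] -/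
theorem decomp_of_letters [Nonempty n] {L N : ℕ} [NeZero L] [NeZero N] (k : ℕ) {ε : ℝ} (hε : 0 < ε)
    {Us U' : Site d → Fin d → (Matrix n n ℂ)ˣ}
    (𝒯 : ℕ → (Site d → Fin d → (Matrix n n ℂ)ˣ) → Set (Site d → Fin d → Matrix n n ℂ)) (hTs : ∀ Y ∈ 𝒯 k Us, IsSkewDir Y)
    {φ : Site d → Fin d → Matrix n n ℂ}
    {u : Site d → (Matrix n n ℂ)ˣ} {X₀ XN : Site d → Fin d → Matrix n n ℂ} {α₀ q₂ q₁ c₁ c₂ c₃ : ℝ} (hq₂ : 0 ≤ q₂) (hc₁ : 0 ≤ c₁) (hc₂ : 0 ≤ c₂) (hc₃ : 0 ≤ c₃)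
    (hu : IsUnitarySite u) (hgauge : gaugeAct u U' = vary Us X₀ 1) (hXs : IsSkewDir X₀) (hXP : IsPeriodicDir X₀ ((N * L ^ (k + 1) : ℕ) : ℤ))
    (hα₀ : 0 ≤ α₀) (hsup : ∀ (x : Site d) (μ : Fin d), ‖X₀ x μ‖ ≤ α₀)
    (hslice : (fun y μ => X₀ y μ - XN y μ) ∈ 𝒯 k Us)
    (hR1 : dirSq XN (periodBox (d := d) (N * L ^ (k + 1)))
      ≤ c₁ * (((L : ℝ) ^ (k + 1)) ^ d / ((L : ℝ) ^ (k + 1)) ^ 2) * dirSq φ (periodBox (d := d) N))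
    (hR2 : curlSq Us XN (periodBox (d := d) (N * L ^ (k + 1)))
      ≤ c₂ * (((L : ℝ) ^ (k + 1)) ^ d / ((L : ℝ) ^ (k + 1)) ^ 4) * dirSq φ (periodBox (d := d) N))
    (hR3 : ∑ p ∈ perWin d (N * L ^ (k + 1)), ‖curl Us XN p‖
      ≤ c₃ * (((L : ℝ) ^ (k + 1)) ^ d / ((L : ℝ) ^ (k + 1)) ^ 2) * dirL1 φ (periodBox (d := d) N))
    (hDL2 : ((L : ℝ) ^ (k + 1)) ^ d / ((L : ℝ) ^ (k + 1)) ^ 4 * dirSq φ (periodBox (d := d) N)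
      ≤ q₂ ^ 2 * energyNormW L (k + 1) Us X₀ (periodBox (d := d) (N * L ^ (k + 1))) ^ 2)
    (hDL1 : ((L : ℝ) ^ (k + 1)) ^ d / ((L : ℝ) ^ (k + 1)) ^ 4 * dirL1 φ (periodBox (d := d) N)
      ≤ q₁ * energyNormW L (k + 1) Us X₀ (periodBox (d := d) (N * L ^ (k + 1))) ^ 2) :
    ∃ (u : Site d → (Matrix n n ℂ)ˣ) (X XT XN : Site d → Fin d → Matrix n n ℂ) (α ν κ : ℝ),
      IsUnitarySite u ∧ IsSkewDir X ∧ IsPeriodicDir X ((N * L ^ (k + 1) : ℕ) : ℤ) ∧ 0 ≤ α ∧ (∀ x μ, ‖X x μ‖ ≤ α) ∧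
      gaugeAct u U' = vary Us X 1 ∧
      X = XT + XN ∧ XT ∈ 𝒯 k Us ∧ IsSkewDir XN ∧ 0 ≤ ν ∧
      energyNormW L (k + 1) Us XN (periodBox (d := d) (N * L ^ (k + 1)))
        ≤ ν * energyNormW L (k + 1) Us X (periodBox (d := d) (N * L ^ (k + 1))) ∧
      ε / ((L : ℝ) ^ (k + 1)) ^ 2 * (∑ p ∈ perWin d (N * L ^ (k + 1)), ‖curl Us XN p‖)
        ≤ κ * energyNormW L (k + 1) Us X (periodBox (d := d) (N * L ^ (k + 1))) ^ 2 ∧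
      α = α₀ ∧ ν = Real.sqrt (c₁ + c₂) * q₂ ∧ κ = ε * c₃ * q₁ := by
  have hL0 : 0 < L := Nat.pos_of_ne_zero (NeZero.ne L)
  set M : ℝ := (L : ℝ) ^ (k + 1) with hMdef
  have hM0 : 0 < M := by positivity
  set F := periodBox (d := d) (N * L ^ (k + 1)) with hF
  -- skewness of `XN` from the slice part
  have hTsk : IsSkewDir (fun y μ => X₀ y μ - XN y μ) := hTs _ hslice
  have hNsk : IsSkewDir XN := fun y μ => by
    have e : XN y μ = X₀ y μ - (X₀ y μ - XN y μ) := (sub_sub_cancel _ _).symm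
    rw [e]; exact (skewAdjoint (Matrix n n ℂ)).sub_mem (hXs y μ) (hTsk y μ)
  -- energies
  set EX : ℝ := energyNormW L (k + 1) Us X₀ F with hEX
  set EN : ℝ := energyNormW L (k + 1) Us XN F with hEN
  have hEX0 : 0 ≤ EX := energyNormW_nonneg _ _ _ _ _
  have hEN0 : 0 ≤ EN := energyNormW_nonneg _ _ _ _ _
  have hdφ0 : 0 ≤ dirSq φ (periodBox (d := d) N) := dirSq_nonneg _ _
  -- (R1)(R2)(DL2) ⇒ `EN² ≤ (c₁+c₂)·(M^d/M⁴)·dirSq φ ≤ (c₁+c₂) q₂² EX²`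
  have hENsq : EN ^ 2 = curlSq Us XN F + (M⁻¹) ^ 2 * dirSq XN F := by
    rw [hEN]; unfold NE3EnergyWeightedShapes.energyNormW
    rw [Real.sq_sqrt (energySq_nonneg L (k + 1) Us XN F)]
  have hEN2 : EN ^ 2 ≤ (c₁ + c₂) * (q₂ ^ 2 * EX ^ 2) := by
    have h1 : (M⁻¹) ^ 2 * dirSq XN F ≤ (M⁻¹) ^ 2 * (c₁ * (M ^ d / M ^ 2) * dirSq φ (periodBox (d := d) N)) :=
      mul_le_mul_of_nonneg_left hR1 (by positivity)
    have h2 : (M⁻¹) ^ 2 * (c₁ * (M ^ d / M ^ 2) * dirSq φ (periodBox (d := d) N)) = c₁ * (M ^ d / M ^ 4 * dirSq φ (periodBox (d := d) N)) := by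
      field_simp
    have h2' : c₂ * (M ^ d / M ^ 4) * dirSq φ (periodBox (d := d) N) = c₂ * (M ^ d / M ^ 4 * dirSq φ (periodBox (d := d) N)) := by ring
    have h3 : EN ^ 2 ≤ (c₁ + c₂) * (M ^ d / M ^ 4 * dirSq φ (periodBox (d := d) N)) := by
      rw [hENsq]
      have h12 := add_le_add hR2 h1
      rw [h2, h2'] at h12
      linarith
    exact h3.trans (by nlinarith [hDL2, hc₁, hc₂])
  have hN1 : EN ≤ Real.sqrt (c₁ + c₂) * q₂ * EX := by
    have hr : 0 ≤ Real.sqrt (c₁ + c₂) * q₂ * EX := mul_nonneg (mul_nonneg (Real.sqrt_nonneg _) hq₂) hEX0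
    have hs2 : Real.sqrt (c₁ + c₂) ^ 2 = c₁ + c₂ := Real.sq_sqrt (add_nonneg hc₁ hc₂)
    have hsq' : EN ^ 2 ≤ (Real.sqrt (c₁ + c₂) * q₂ * EX) ^ 2 := by
      have e : (Real.sqrt (c₁ + c₂) * q₂ * EX) ^ 2 = Real.sqrt (c₁ + c₂) ^ 2 * (q₂ ^ 2 * EX ^ 2) := by ring
      rw [e, hs2]; exact hEN2
    exact (pow_le_pow_iff_left₀ hEN0 hr (by norm_num : (2 : ℕ) ≠ 0)).1 hsq'
  -- (R3)(DL1) ⇒ the ℓ¹-curl letter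
  have hN2 : ε / M ^ 2 * (∑ p ∈ perWin d (N * L ^ (k + 1)), ‖curl Us XN p‖) ≤ ε * c₃ * q₁ * EX ^ 2 := by
    have h1 : ε / M ^ 2 * (∑ p ∈ perWin d (N * L ^ (k + 1)), ‖curl Us XN p‖)
        ≤ ε / M ^ 2 * (c₃ * (M ^ d / M ^ 2) * dirL1 φ (periodBox (d := d) N)) := mul_le_mul_of_nonneg_left hR3 (by positivity)
    have h2 : ε / M ^ 2 * (c₃ * (M ^ d / M ^ 2) * dirL1 φ (periodBox (d := d) N)) = ε * c₃ * (M ^ d / M ^ 4 * dirL1 φ (periodBox (d := d) N)) := by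
      field_simp
    rw [h2] at h1
    have h3 : ε * c₃ * (M ^ d / M ^ 4 * dirL1 φ (periodBox (d := d) N)) ≤ ε * c₃ * (q₁ * EX ^ 2) :=
      mul_le_mul_of_nonneg_left hDL1 (by positivity)
    linarith
  refine ⟨u, X₀, fun y μ => X₀ y μ - XN y μ, XN, α₀, Real.sqrt (c₁ + c₂) * q₂, ε * c₃ * q₁, hu, hXs, hXP, hα₀, hsup, hgauge,
    ?_, hslice, hNsk, by positivity, hN1, hN2, rfl, rfl, rfl⟩
  funext y μ; simp only [Pi.add_apply, sub_add_cancel]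

end

end Summit.QuantumFields.BalabanUV.T4Continuum.NE7DecompOfLettersGeneric
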